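import Summits.CriticalPhenomena.PercolationContinuityZ3.Theorems.SahiLatticeFieldMeasures
import Literature.MathematicalPhysics.QuantumLattice.LatticeScalarFieldProofs

/-!
# Unconditionally, every order: functions of two field values under box-TP₂ laws on `ℝ^V` (lattice `φ⁴`, Griffiths–Simon fields)

Support file of the Sahi cell (`prim-sahi`, typer seat, generation 13; `--supports stmt-CriticalPhenomena-4575`).
Theorems only (no definitions, no named facts, no sorries).  Continuous-spin companion of `SahiIsingThreeSites.lean`.

* `IsBoxTP2.map_restrictInj` — **box-TP₂ on `ℝ^V` passes to the law of any sub-family of coordinates**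
  (`φ ↦ φ ∘ j`, `j : W → V` injective; `V` finite, finite measure): the preimage of a box of `ℝ^W` is the increasing
  union of the boxes of `ℝ^V` with the prescribed faces over `j(W)` and faces `[−N, N]` elsewhere (`Function.extend`),
  and truncations at a common level have the right meets and joins (continuity from below).  (The unit-cube case is
  generation 12's `IsBoxTP2.map_restrictComp`, where `⊥, ⊤` replace the truncation.)
* `msahiE_comp_restrictInj_nonneg_of_card_le_two` — **for a box-TP₂ probability measure on `ℝ^V` and `|W| ≤ 2`:
  `E_n(g_0(φ ∘ j), …, g_{n−1}(φ ∘ j)) ≥ 0` for EVERY `n` and all bounded measurable nonnegative monotone `g_i` on `ℝ^W`,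
  UNCONDITIONALLY** (`liebSahiContinuum_of_le_two`: the continuum conjecture is a theorem in dimension `≤ 2`).
* The fields: `latticeFieldMeasure_msahiE_twoValues_nonneg` (any single-site law, `J ≥ 0`, normalisable) and
  `phi4_msahiE_twoValues_nonneg` (`g > 0`, `J ≥ 0`): **Sahi positivity of every order for functionals of any two
  field values `(φ_x, φ_y)` of a ferromagnetic lattice field**, unconditionally.

No sorries, no new axioms.
-/

noncomputable section

namespace Summit.CriticalPhenomena.PercolationContinuityZ3.Theorems.SahiBoxTP2

open MeasureTheory ProbabilityTheory Set Filter Topology Function Literature.Combinatorics.Sahi2008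
open Literature.Probability.LatticeModels Literature.MathematicalPhysics.QuantumLattice
open scoped ENNReal

/-! ### Box-TP₂ passes to sub-families of real coordinates -/

section Restrict

variable {V W : Type*} [Fintype V] [Fintype W] {j : W → V}

omit [Fintype V] [Fintype W] in
/-- The truncated box over a sub-family: faces `[a w, b w]` at `j w`, `[−N, N]` at the other coordinates. [folklore] -/
theorem mem_Icc_extend_iff (hj : Injective j) (a b : W → ℝ) (N : ℝ) (φ : V → ℝ) :
    φ ∈ Icc (Function.extend j a fun _ => -N) (Function.extend j b fun _ => N) ↔
      (∀ w, a w ≤ φ (j w) ∧ φ (j w) ≤ b w) ∧ ∀ v, (¬∃ w, j w = v) → -N ≤ φ v ∧ φ v ≤ N := by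
  classical
  simp only [mem_Icc, Pi.le_def]
  constructor
  · rintro ⟨h1, h2⟩
    refine ⟨fun w => ?_, fun v hv => ?_⟩
    · have h1w := h1 (j w)
      have h2w := h2 (j w)
      rw [hj.extend_apply] at h1w h2w
      exact ⟨h1w, h2w⟩
    · have h1v := h1 v
      have h2v := h2 v
      rw [Function.extend_apply' _ _ _ hv] at h1v h2v
      exact ⟨h1v, h2v⟩
  · rintro ⟨hW, hV⟩
    refine ⟨fun v => ?_, fun v => ?_⟩
    · by_cases hv : ∃ w, j w = v
      · obtain ⟨w, rfl⟩ := hv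
        rw [hj.extend_apply]; exact (hW w).1
      · rw [Function.extend_apply' _ _ _ hv]; exact (hV v hv).1
    · by_cases hv : ∃ w, j w = v
      · obtain ⟨w, rfl⟩ := hv
        rw [hj.extend_apply]; exact (hW w).2
      · rw [Function.extend_apply' _ _ _ hv]; exact (hV v hv).2

omit [Fintype V] [Fintype W] in
/-- Extension by a common constant commutes with meets. [folklore] -/
theorem extend_inf (hj : Injective j) (a a' : W → ℝ) (c : ℝ) :
    Function.extend j (a ⊓ a') (fun _ => c) = Function.extend j a (fun _ => c) ⊓ Function.extend j a' fun _ => c := by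
  classical
  funext v
  by_cases hv : ∃ w, j w = v
  · obtain ⟨w, rfl⟩ := hv
    simp only [Pi.inf_apply, hj.extend_apply]
  · simp only [Pi.inf_apply, Function.extend_apply' _ _ _ hv, inf_idem]

omit [Fintype V] [Fintype W] in
/-- Extension by a common constant commutes with joins. [folklore] -/
theorem extend_sup (hj : Injective j) (a a' : W → ℝ) (c : ℝ) :
    Function.extend j (a ⊔ a') (fun _ => c) = Function.extend j a (fun _ => c) ⊔ Function.extend j a' fun _ => c := by
  classical
  funext v
  by_cases hv : ∃ w, j w = v
  · obtain ⟨w, rfl⟩ := hv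
    simp only [Pi.sup_apply, hj.extend_apply]
  · simp only [Pi.sup_apply, Function.extend_apply' _ _ _ hv, sup_idem]

omit [Fintype V] [Fintype W] in
/-- The truncated boxes increase with the level. [folklore] -/
theorem monotone_Icc_extend (hj : Injective j) (a b : W → ℝ) :
    Monotone fun N : ℕ => Icc (Function.extend j a fun _ => -(N : ℝ)) (Function.extend j b fun _ => (N : ℝ)) := by
  intro N N' hNN' φ hφ
  rw [mem_Icc_extend_iff hj] at hφ ⊢
  refine ⟨hφ.1, fun v hv => ?_⟩
  have h := hφ.2 v hv
  have hc : (N : ℝ) ≤ N' := Nat.cast_le.2 hNN'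
  exact ⟨by linarith [h.1], by linarith [h.2]⟩

omit [Fintype W] in
/-- The truncated boxes exhaust the preimage of the box of `ℝ^W`. [folklore] -/
theorem iUnion_Icc_extend (hj : Injective j) (a b : W → ℝ) :
    ⋃ N : ℕ, Icc (Function.extend j a fun _ => -(N : ℝ)) (Function.extend j b fun _ => (N : ℝ)) =
      (fun φ : V → ℝ => φ ∘ j) ⁻¹' Icc a b := by
  ext φ
  simp only [mem_iUnion, mem_preimage]
  constructor
  · rintro ⟨N, hN⟩
    rw [mem_Icc_extend_iff hj] at hN
    exact ⟨fun w => (hN.1 w).1, fun w => (hN.1 w).2⟩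
  · rintro ⟨h1, h2⟩
    refine ⟨⌈∑ v, |φ v|⌉₊, ?_⟩
    rw [mem_Icc_extend_iff hj]
    refine ⟨fun w => ⟨h1 w, h2 w⟩, fun v _ => ?_⟩
    have hv : |φ v| ≤ (⌈∑ u, |φ u|⌉₊ : ℝ) :=
      (Finset.single_le_sum (f := fun u => |φ u|) (fun u _ => abs_nonneg _) (Finset.mem_univ v)).trans
        (Nat.le_ceil _)
    exact ⟨by linarith [neg_abs_le (φ v)], by linarith [le_abs_self (φ v)]⟩

/-- **Box-TP₂ on `ℝ^V` passes to the law of any sub-family of coordinates** (finite measure, `V` finite, `j`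
injective). [this work] -/
theorem IsBoxTP2.map_restrictInj {μ : Measure (V → ℝ)} [IsFiniteMeasure μ] (hμ : IsBoxTP2 μ) (hj : Injective j) :
    IsBoxTP2 (μ.map fun φ : V → ℝ => φ ∘ j) := by
  have hr : Measurable fun φ : V → ℝ => φ ∘ j := measurable_pi_lambda _ fun w => measurable_pi_apply (j w)
  set B : (W → ℝ) → (W → ℝ) → ℕ → Set (V → ℝ) :=
    fun p q N => Icc (Function.extend j p fun _ => -(N : ℝ)) (Function.extend j q fun _ => (N : ℝ)) with hB
  have hlim : ∀ p q : W → ℝ, Tendsto (fun N => μ (B p q N)) atTop (𝓝 ((μ.map fun φ : V → ℝ => φ ∘ j) (Icc p q))) := by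
    intro p q
    rw [Measure.map_apply hr measurableSet_Icc, ← iUnion_Icc_extend hj p q]
    exact tendsto_measure_iUnion_atTop (monotone_Icc_extend hj p q)
  have hfin : ∀ s : Set (W → ℝ), (μ.map fun φ : V → ℝ => φ ∘ j) s ≠ ∞ := fun s => measure_ne_top _ s
  intro a b a' b'
  refine le_of_tendsto_of_tendsto'
    (ENNReal.Tendsto.mul (hlim a b) (Or.inr (hfin _)) (hlim a' b') (Or.inr (hfin _)))
    (ENNReal.Tendsto.mul (hlim (a ⊓ a') (b ⊓ b')) (Or.inr (hfin _)) (hlim (a ⊔ a') (b ⊔ b'))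
      (Or.inr (hfin _))) fun N => ?_
  have key := hμ (Function.extend j a fun _ => -(N : ℝ)) (Function.extend j b fun _ => (N : ℝ))
    (Function.extend j a' fun _ => -(N : ℝ)) (Function.extend j b' fun _ => (N : ℝ))
  simp only [hB, extend_inf hj, extend_sup hj]
  exact key

end Restrict

/-! ### Two coordinates, every order, unconditionally -/

section TwoValues

variable {V W : Type*} [Fintype V] [Fintype W] {n : ℕ}

/-- **Functions of a sub-family of at most two coordinates of a box-TP₂ law on `ℝ^V` have `E_n ≥ 0` for EVERY `n`**
(bounded measurable nonnegative monotone `g_i` on `ℝ^W`, `|W| ≤ 2`; UNCONDITIONAL: the two-dimensional continuum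
case is a theorem, `liebSahiContinuum_of_le_two`). [this work] -/
theorem msahiE_comp_restrictInj_nonneg_of_card_le_two (hW : Fintype.card W ≤ 2) {j : W → V} (hj : Injective j)
    (μ : Measure (V → ℝ)) [IsProbabilityMeasure μ] (hμ : IsBoxTP2 μ) (g : Fin n → (W → ℝ) → ℝ)
    (hgm : ∀ i, Measurable (g i)) (hg0 : ∀ i x, 0 ≤ g i x) {M : ℝ} (hgM : ∀ i x, g i x ≤ M)
    (hmono : ∀ i, Monotone (g i)) : 0 ≤ msahiE μ n fun i φ => g i (φ ∘ j) := by
  have hr : Measurable fun φ : V → ℝ => φ ∘ j := measurable_pi_lambda _ fun w => measurable_pi_apply (j w)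
  haveI : IsProbabilityMeasure (μ.map fun φ : V → ℝ => φ ∘ j) := Measure.isProbabilityMeasure_map hr.aemeasurable
  have hmp : MeasurePreserving (fun φ : V → ℝ => φ ∘ j) μ (μ.map fun φ : V → ℝ => φ ∘ j) := ⟨hr, rfl⟩
  have key := msahiE_nonneg_of_isBoxTP2_realFun (liebSahiContinuum_of_le_two hW n) _ (hμ.map_restrictInj hj) g hgm
    hg0 hgM hmono
  rwa [← msahiE_comp_measurePreserving_of_measurable hmp n g hgm] at key

/-- Decreasing families. [this work] -/
theorem msahiE_comp_restrictInj_nonneg_of_card_le_two_antitone (hW : Fintype.card W ≤ 2) {j : W → V}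
    (hj : Injective j) (μ : Measure (V → ℝ)) [IsProbabilityMeasure μ] (hμ : IsBoxTP2 μ)
    (g : Fin n → (W → ℝ) → ℝ) (hgm : ∀ i, Measurable (g i)) (hg0 : ∀ i x, 0 ≤ g i x) {M : ℝ}
    (hgM : ∀ i x, g i x ≤ M) (hanti : ∀ i, Antitone (g i)) : 0 ≤ msahiE μ n fun i φ => g i (φ ∘ j) := by
  have hr : Measurable fun φ : V → ℝ => φ ∘ j := measurable_pi_lambda _ fun w => measurable_pi_apply (j w)
  haveI : IsProbabilityMeasure (μ.map fun φ : V → ℝ => φ ∘ j) := Measure.isProbabilityMeasure_map hr.aemeasurable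
  have hmp : MeasurePreserving (fun φ : V → ℝ => φ ∘ j) μ (μ.map fun φ : V → ℝ => φ ∘ j) := ⟨hr, rfl⟩
  have key := msahiE_nonneg_of_isBoxTP2_realFun_antitone (liebSahiContinuum_of_le_two hW n) _
    (hμ.map_restrictInj hj) g hgm hg0 hgM hanti
  rwa [← msahiE_comp_measurePreserving_of_measurable hmp n g hgm] at key

variable (G : SimpleGraph V) [DecidableRel G.Adj]

/-- **Ferromagnetic lattice fields with arbitrary single-site law: functionals of at most two field values are
Sahi-positive of EVERY order, unconditionally** (`J ≥ 0`, normalisable tilt). [this work] -/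
theorem latticeFieldMeasure_msahiE_twoValues_nonneg (hW : Fintype.card W ≤ 2) {j : W → V} (hj : Injective j)
    (ν : Measure ℝ) [SigmaFinite ν] {J : ℝ} (hJ : 0 ≤ J) [IsProbabilityMeasure (latticeFieldMeasure G ν J)]
    (g : Fin n → (W → ℝ) → ℝ) (hgm : ∀ i, Measurable (g i)) (hg0 : ∀ i x, 0 ≤ g i x) {M : ℝ}
    (hgM : ∀ i x, g i x ≤ M) (hmono : ∀ i, Monotone (g i)) :
    0 ≤ msahiE (latticeFieldMeasure G ν J) n fun i φ => g i (φ ∘ j) :=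
  msahiE_comp_restrictInj_nonneg_of_card_le_two hW hj _ (isBoxTP2_latticeFieldMeasure G ν hJ) g hgm hg0 hgM hmono

/-- **The lattice `φ⁴` field (`g > 0`, `J ≥ 0`): functionals of at most two field values are Sahi-positive of EVERY
order, unconditionally.** [this work] -/
theorem phi4_msahiE_twoValues_nonneg (hW : Fintype.card W ≤ 2) {j : W → V} (hj : Injective j) {g₄ : ℝ}
    (hg : 0 < g₄) (κ : ℝ) {J : ℝ} (hJ : 0 ≤ J) (g : Fin n → (W → ℝ) → ℝ) (hgm : ∀ i, Measurable (g i))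
    (hg0 : ∀ i x, 0 ≤ g i x) {M : ℝ} (hgM : ∀ i x, g i x ≤ M) (hmono : ∀ i, Monotone (g i)) :
    0 ≤ msahiE (phi4Measure G g₄ κ J) n fun i φ => g i (φ ∘ j) := by
  haveI := isProbabilityMeasure_phi4Measure_holds G hg κ J
  exact msahiE_comp_restrictInj_nonneg_of_card_le_two hW hj _ (isBoxTP2_phi4Measure G g₄ κ hJ) g hgm hg0 hgM hmono

/-- The `φ⁴` field, two values, decreasing families. [this work] -/
theorem phi4_msahiE_twoValues_nonneg_antitone (hW : Fintype.card W ≤ 2) {j : W → V} (hj : Injective j) {g₄ : ℝ}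
    (hg : 0 < g₄) (κ : ℝ) {J : ℝ} (hJ : 0 ≤ J) (g : Fin n → (W → ℝ) → ℝ) (hgm : ∀ i, Measurable (g i))
    (hg0 : ∀ i x, 0 ≤ g i x) {M : ℝ} (hgM : ∀ i x, g i x ≤ M) (hanti : ∀ i, Antitone (g i)) :
    0 ≤ msahiE (phi4Measure G g₄ κ J) n fun i φ => g i (φ ∘ j) := by
  haveI := isProbabilityMeasure_phi4Measure_holds G hg κ J
  exact msahiE_comp_restrictInj_nonneg_of_card_le_two_antitone hW hj _ (isBoxTP2_phi4Measure G g₄ κ hJ) g hgm hg0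
    hgM hanti

end TwoValues

end Summit.CriticalPhenomena.PercolationContinuityZ3.Theorems.SahiBoxTP2
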